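import Literature.Barriers.CriticalPhenomena.LongRangeTrivialityOnZ3
import Literature.Probability.LatticeModels.GKSInequalities

/-!
# Proofs for `LongRangeTrivialityOnZ3`: the smeared variances are bounded, `⟨T_{f,L,β}²⟩_β ≤ C_f`

Sibling of `Literature/Barriers/CriticalPhenomena/LongRangeTrivialityOnZ3.lean` (barrier catalogue
D-0021, sub-problem `Ising3DConformalLimit`). It **discharges** the named fact
`Literature.Barriers.CriticalPhenomena.panis_variance_bound` — Panis, *Triviality of the scaling limits of
critical Ising and `φ⁴` models with effective dimension at least four*, arXiv:2309.05797 = Ann.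
Probab. 54 (2026), §1.2.1, footnote to the definition of `T_{f,L,β}` (p. 6 of the arXiv version):
"for `f = 1_{[-1,1]^d}`, `⟨T_{f,L,β}(σ)²⟩_β = 1`, and more generally for `f ≠ 0`, one has
`0 < c_f ≤ ⟨T_{f,L,β}(σ)²⟩_β ≤ C_f < ∞` … by constants that only depend on `f`" — in the vendored
form (upper bound, at `β = β_c`, for `J_{x,y} = C₀|x-y|₁^{-d-α}`):
`theorem panis_variance_bound_holds : panis_variance_bound`.

The source prints no proof of the footnote (its §5 compares `χ_{2dr_fL}` with `χ_L` through the
sliding-scale infrared bound, far more than is needed here). The proof below is the elementary one,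
valid for every ferromagnetic (`J ≥ 0`) translation-invariant pair interaction on `ℤ^d` and every
`β ≥ 0` (`LongRangeIsing.state_smeared_sq_le`), with `C_f = ‖f‖_∞² (2N_f+1)^{2d}` where `f(x/L) = 0`
off `Λ_{N_fL}`:

* `⟨T_{f,L,β}²⟩_β = Σ_L(β)⁻¹ ∑_{x,y ∈ Λ_{N_fL}} f(x/L) f(y/L) ⟨σ_xσ_y⟩_β ≤
  ‖f‖_∞² Σ_L(β)⁻¹ ∑_{x,y∈Λ_{N_fL}} ⟨σ_xσ_y⟩_β` by Griffiths' first inequality `⟨σ_xσ_y⟩_β ≥ 0`;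
* `Λ_{NL}` is covered by the `(2N+1)^d` translates `Λ_L + (2L+1)k`, `k ∈ Λ_N`, and for two blocks
  `2∑_{x∈B₁,y∈B₂}⟨σ_xσ_y⟩ ≤ ∑_{B₁²}⟨σ_xσ_y⟩ + ∑_{B₂²}⟨σ_xσ_y⟩` because the two-point function is a
  positive semi-definite kernel (`⟨(∑ᵢcᵢσ_{xᵢ})²⟩ ≥ 0` in finite volume, passed to the limit);
  each diagonal block equals `Σ_L(β)` by translation invariance of the infinite-volume state, whence
  `∑_{Λ_{NL}²}⟨σ_xσ_y⟩ ≤ (2N+1)^{2d} Σ_L(β)`; and `Σ_L(β) ≥ |Λ_L| ≥ 1`.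

The statistical-mechanics input is the tree's sorry-free GKS machinery
(`Literature.Probability.LatticeModels.GKSInequalities`, after Friedli–Velenik §3.8.1): the
finite-volume Gibbs expectation `LongRangeIsing.expectIn J Λ β 0` of the barrier file *is* the
expectation `gksExpect` of the spin system `ν_{Λ;K}` with couplings `K_{(z,w)} = (β/2)J_{z,w}` on the
ordered pairs of `Λ` and supports `{z} ∆ {w}` (`expectIn_eq_gksExpect`), so GKS I
(`gksExpect_spinProduct_nonneg`), Griffiths' comparison of couplings (`gksExpect_mono_of_abs_le`,
giving monotonicity in the volume through the decoupled couplings and `exists_sum_comp_eq_smul`)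
apply; the infinite-volume state `LongRangeIsing.state` (a `limUnder` along boxes) is then an actual
limit on spin products for `β ≥ 0`, `J ≥ 0` (`tendsto_expectIn_box`), nonnegative, dominating every
finite-volume free expectation (`expectIn_le_state`) and translation invariant
(`state_spinProduct_map_addRight`, from the covariance `expectIn_map_equiv` of the finite sums under
a `J`-preserving bijection of `ℤ^d`). At `β_c` this applies because `β_c = sInf {β > 0 | m*(β) > 0} ≥ 0`
and `C₀|x-y|₁^{-d-α} ≥ 0` is translation invariant.

## Contents (namespace `Literature.Barriers.CriticalPhenomena.LongRangeIsing`, then the discharge)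

* Finite volume: `expectIn_add/const_mul/finset_sum/const/nonneg/mono`, `abs_expectIn_le_one`;
  bridge `gksHamiltonian_pair(_restrict)`, `pairGibbsWeight_eq_gksWeight`, `expectIn_eq_gksExpect`,
  `expectIn_spinProduct_eq_gksExpect`, GKS I `expectIn_spinProduct_nonneg`; volume monotonicity
  `expectIn_spinProduct_eq_gksExpect_decoupled`, `expectIn_spinProduct_mono_volume`; covariance
  `pairHamiltonian_map_equiv`, `expectIn_map_equiv`, `expectIn_spinProduct_map_addRight`.
* Box limit: `tendsto_expectIn_box`, `expectIn_le_state`, `state_spinProduct_nonneg`, `state_const`,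
  `state_spinProduct_map_addRight`.
* Two-point kernel: `tendsto_expectIn_box_sum₂`, `state_sum₂`, `sum_sum_mul_state_nonneg` (PSD),
  `two_mul_sum_sum_state_le` (blocks), `state_pair_add`, `state_pair_self`, `blockVariance_eq_sum`,
  `one_le_blockVariance`.
* Combinatorics: `sum_box_mul_le_of_nonneg`, `sum_sum_box_mul_le` (covering `Λ_{NL}` by translates).
* `exists_box_of_hasCompactSupport`, `smeared_sq_eq`, `state_smeared_sq_le`;
  `algebraicCoupling_nonneg`, `algebraicCoupling_add`, `criticalBeta_nonneg`,
  `panis_variance_bound_holds`.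

## Mathlib / tree anchors

`Finset.sum_fiberwise_of_maps_to`, `Finset.sum_image`, `Finset.sum_le_sum_of_subset_of_nonneg`,
`Int.mul_ediv_add_emod`, `Int.le_ediv_iff_mul_le`, `Int.ediv_lt_iff_lt_mul` (covering);
`HasCompactSupport.exists_pos_le_norm`, `Continuous.bounded_above_of_compact_support`,
`PiLp.norm_apply_le`, `finsum_eq_sum_of_support_subset` (the smeared sum is finite);
`tendsto_atTop_ciSup`, `Filter.tendsto_add_atTop_iff_nat`, `tendsto_nhds_limUnder`,
`Filter.Tendsto.limUnder_eq`, `ge_of_tendsto`, `Real.sInf_nonneg`; tree: `gksExpect_spinProduct_nonneg`,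
`gksExpect_mono_of_abs_le`, `exists_sum_comp_eq_smul`, `volIncl`, `spinAt_glue_comp_volIncl`,
`inVol`, `prod_inVol`, `exists_forall_subset_box`, `box_mono`, `spinProduct_mul_eq_spinProduct_symmDiff`.

## References

* R. Panis, arXiv:2309.05797 (2023) = Ann. Probab. 54 (2026), §1.2.1 (footnote on `⟨T_{f,L,β}²⟩`,
  `Σ_L(β)`, `T_{f,L,β}`, `β_c`, (A1)–(A5)), Theorem 1.2 (`r_f`) [Panis2023Triviality] (held, read:
  `lit read arxiv:2309.05797 --pages 6`).
* S. Friedli, Y. Velenik, *Statistical Mechanics of Lattice Systems*, CUP (2017), §3.8.1 Thm. 3.49,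
  Exercises 3.12, 3.14, 3.31 [FriedliVelenik2017].
* R. B. Griffiths, J. Math. Phys. 8 (1967) 478–489; J. Ginibre, Comm. Math. Phys. 16 (1970) 310–328.
-/

noncomputable section

namespace Literature.Barriers.CriticalPhenomena

open Literature.Probability.LatticeModels Literature.Probability.Percolation Filter Topology Finset
open scoped symmDiff

namespace LongRangeIsing

variable {d : ℕ}

/-! ### Finite volume: linearity, positivity -/

section FiniteVolume

variable (J : Site d → Site d → ℝ) (Λ : Finset (Site d)) (β h : ℝ)

/-- Boltzmann weights are positive. [folklore] -/
theorem pairGibbsWeight_pos (τ : Λ → ℤˣ) : 0 < pairGibbsWeight J Λ β h τ := Real.exp_pos _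

/-- The partition function `Z(Λ,J,h,β) > 0`. [folklore] -/
theorem partitionSum_pos : 0 < ∑ τ : Λ → ℤˣ, pairGibbsWeight J Λ β h τ :=
  Finset.sum_pos (fun τ _ => pairGibbsWeight_pos J Λ β h τ) Finset.univ_nonempty

/-- Additivity of `⟨·⟩_{Λ,J,h,β}`. [folklore] -/
theorem expectIn_add (F G : SpinConfig (Site d) → ℝ) :
    expectIn J Λ β h (fun σ => F σ + G σ) = expectIn J Λ β h F + expectIn J Λ β h G := by
  simp only [expectIn, add_mul, Finset.sum_add_distrib, add_div]

/-- Homogeneity of `⟨·⟩_{Λ,J,h,β}`. [folklore] -/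
theorem expectIn_const_mul (a : ℝ) (F : SpinConfig (Site d) → ℝ) :
    expectIn J Λ β h (fun σ => a * F σ) = a * expectIn J Λ β h F := by
  simp only [expectIn, mul_assoc, ← Finset.mul_sum, mul_div_assoc]

/-- `⟨·⟩_{Λ,J,h,β}` commutes with finite sums. [folklore] -/
theorem expectIn_finset_sum {ι : Type*} (s : Finset ι) (F : ι → SpinConfig (Site d) → ℝ) :
    expectIn J Λ β h (fun σ => ∑ i ∈ s, F i σ) = ∑ i ∈ s, expectIn J Λ β h (F i) := by
  simp only [expectIn, Finset.sum_mul, Finset.sum_div]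
  exact Finset.sum_comm

/-- `⟨c⟩_{Λ,J,h,β} = c`. [folklore] -/
theorem expectIn_const (c : ℝ) : expectIn J Λ β h (fun _ => c) = c := by
  rw [expectIn, ← Finset.mul_sum, mul_div_assoc, div_self (partitionSum_pos J Λ β h).ne', mul_one]

/-- `⟨F⟩_{Λ,J,h,β} ≥ 0` for `F ≥ 0`. [folklore] -/
theorem expectIn_nonneg {F : SpinConfig (Site d) → ℝ} (hF : ∀ σ, 0 ≤ F σ) :
    0 ≤ expectIn J Λ β h F :=
  div_nonneg (Finset.sum_nonneg fun τ _ => mul_nonneg (hF _) (pairGibbsWeight_pos J Λ β h τ).le)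
    (partitionSum_pos J Λ β h).le

/-- `⟨·⟩_{Λ,J,h,β}` is monotone. [folklore] -/
theorem expectIn_mono {F G : SpinConfig (Site d) → ℝ} (hFG : ∀ σ, F σ ≤ G σ) :
    expectIn J Λ β h F ≤ expectIn J Λ β h G := by
  have h1 : expectIn J Λ β h G - expectIn J Λ β h F = expectIn J Λ β h (fun σ => G σ - F σ) := by
    simp only [expectIn, sub_mul, Finset.sum_sub_distrib, sub_div]
  have h2 : 0 ≤ expectIn J Λ β h (fun σ => G σ - F σ) :=
    expectIn_nonneg J Λ β h fun σ => sub_nonneg.2 (hFG σ)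
  linarith

/-- `|⟨F⟩_{Λ,J,h,β}| ≤ 1` for `|F| ≤ 1`. [folklore] -/
theorem abs_expectIn_le_one {F : SpinConfig (Site d) → ℝ} (hF : ∀ σ, |F σ| ≤ 1) :
    |expectIn J Λ β h F| ≤ 1 := by
  rw [abs_le]
  constructor
  · have h1 := expectIn_mono J Λ β h (F := fun _ => (-1 : ℝ)) (G := F) fun σ => (abs_le.1 (hF σ)).1
    rwa [expectIn_const] at h1
  · have h1 := expectIn_mono J Λ β h (F := F) (G := fun _ => (1 : ℝ)) fun σ => (abs_le.1 (hF σ)).2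
    rwa [expectIn_const] at h1

end FiniteVolume

/-! ### The pair interaction as a ferromagnetic spin system on `↥Λ` (bridge to `gksExpect`) -/

section Bridge

variable (J : Site d → Site d → ℝ) (Λ : Finset (Site d)) (β : ℝ)

/-- `σ_x σ_y = σ_{{x} ∆ {y}}` (`σ_x² = 1`). [folklore] -/
theorem spinAt_mul_spinAt_eq_spinProduct {V : Type*} [DecidableEq V] (x y : V) (σ : SpinConfig V) :
    spinAt x σ * spinAt y σ = spinProduct ({x} ∆ {y}) σ := by
  rw [← spinProduct_mul_eq_spinProduct_symmDiff]
  simp [spinProduct]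

/-- With the free boundary condition (outside spins `+1`), `σ_A(τ·free) = τ_{A ∩ Λ}` for every
finite `A` (not only `A ⊆ Λ`). [folklore] -/
theorem spinProduct_glue_free (A : Finset (Site d)) (τ : SpinConfig ↥Λ) :
    spinProduct A (glue Λ τ .free) = spinProduct (inVol Λ A) τ := by
  rw [spinProduct, spinProduct]
  have hR : ∏ z ∈ inVol Λ A, spinAt z τ = ∏ x ∈ Λ.filter (· ∈ A), spinAt x (glue Λ τ .free) := by
    rw [← prod_inVol Λ A (fun x => spinAt x (glue Λ τ .free))]
    exact Finset.prod_congr rfl fun z _ => (spinAt_glue_coe τ .free z).symm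
  rw [hR, ← Finset.prod_filter_mul_prod_filter_not A (· ∈ Λ)]
  have h1 : ∏ x ∈ A.filter (fun x => ¬ x ∈ Λ), spinAt x (glue Λ τ .free) = 1 := by
    refine Finset.prod_eq_one fun x hx => ?_
    rw [spinAt_glue_of_not_mem τ .free (Finset.mem_filter.1 hx).2]
    simp [spinAt]
  rw [h1, mul_one, Finset.filter_mem_eq_inter, Finset.filter_mem_eq_inter, Finset.inter_comm]

/-- The energy of the pair system `ν_{Λ;K}` with couplings `K_{(z,w)} = (β/2) J_{z,w} 1{z,w ∈ Λ₁}`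
on the ordered pairs of `Λ ⊇ Λ₁` and supports `{z} ∆ {w}`, in lattice coordinates:
`∑ K σσ = (β/2) ∑_{x,y ∈ Λ₁} J_{x,y} σ_x σ_y`. [folklore] -/
theorem gksHamiltonian_pair_restrict {Λ₁ : Finset (Site d)} (h1 : Λ₁ ⊆ Λ) (τ : SpinConfig ↥Λ) :
    gksHamiltonian (univ : Finset (↥Λ × ↥Λ))
        (fun p => if (p.1 : Site d) ∈ Λ₁ ∧ (p.2 : Site d) ∈ Λ₁ then β / 2 * J p.1 p.2 else 0)
        (fun p => {p.1} ∆ {p.2}) τ =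
      β / 2 * ∑ x ∈ Λ₁, ∑ y ∈ Λ₁, J x y * (spinAt x (glue Λ τ .free) * spinAt y (glue Λ τ .free)) := by
  set σ := glue Λ τ .free with hσ
  rw [gksHamiltonian, Fintype.sum_prod_type]
  have hL : ∑ z : ↥Λ, ∑ w : ↥Λ,
      (if ((z, w).1 : Site d) ∈ Λ₁ ∧ ((z, w).2 : Site d) ∈ Λ₁ then β / 2 * J (z, w).1 (z, w).2 else 0) *
        spinProduct ({(z, w).1} ∆ {(z, w).2}) τ =
      ∑ x ∈ Λ, ∑ y ∈ Λ, (if x ∈ Λ₁ ∧ y ∈ Λ₁ then β / 2 * J x y else 0) * (spinAt x σ * spinAt y σ) := by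
    rw [← Finset.sum_coe_sort Λ]
    refine Finset.sum_congr rfl fun z _ => ?_
    rw [← Finset.sum_coe_sort Λ]
    refine Finset.sum_congr rfl fun w _ => ?_
    rw [hσ, spinAt_glue_coe, spinAt_glue_coe, spinAt_mul_spinAt_eq_spinProduct]
  rw [hL, Finset.mul_sum]
  symm
  refine (Finset.sum_congr rfl fun x hx => ?_).trans (Finset.sum_subset h1 fun x _ hx => ?_)
  · rw [Finset.mul_sum]
    refine (Finset.sum_congr rfl fun y hy => ?_).trans (Finset.sum_subset h1 fun y _ hy => ?_)
    · rw [if_pos ⟨hx, hy⟩]; ring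
    · rw [if_neg (fun h' => hy h'.2), zero_mul]
  · exact Finset.sum_eq_zero fun y _ => by rw [if_neg (fun h' => hx h'.1), zero_mul]

/-- The energy of the pair system on `Λ` with couplings `(β/2) J_{z,w}` on all ordered pairs is
`-β H_{Λ,J,0}`: `∑_{(z,w)} (β/2) J_{z,w} τ_z τ_w = (β/2) ∑_{x,y∈Λ} J_{x,y} σ_x σ_y`.
[cite: Panis2023Triviality, §1.2.1 (H_{Λ,J,h})] -/
theorem gksHamiltonian_pair (τ : SpinConfig ↥Λ) :
    gksHamiltonian (univ : Finset (↥Λ × ↥Λ)) (fun p => β / 2 * J p.1 p.2) (fun p => {p.1} ∆ {p.2}) τ =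
      -β * pairHamiltonian J Λ 0 (glue Λ τ .free) := by
  have h := gksHamiltonian_pair_restrict J Λ β (subset_refl Λ) τ
  have hK : (fun p : ↥Λ × ↥Λ => if (p.1 : Site d) ∈ Λ ∧ (p.2 : Site d) ∈ Λ then β / 2 * J p.1 p.2 else 0) =
      fun p => β / 2 * J p.1 p.2 := by
    funext p
    rw [if_pos ⟨p.1.2, p.2.2⟩]
  rw [hK] at h
  rw [h, pairHamiltonian, zero_mul, sub_zero]
  simp_rw [mul_assoc]
  ring

/-- The Gibbs weight of the pair interaction at `h = 0` is the weight of the spin system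
`ν_{Λ;K}` of Friedli–Velenik §3.8.1 with `K_{(z,w)} = (β/2) J_{z,w}`. [folklore] -/
theorem pairGibbsWeight_eq_gksWeight (τ : SpinConfig ↥Λ) :
    pairGibbsWeight J Λ β 0 τ =
      gksWeight (univ : Finset (↥Λ × ↥Λ)) (fun p => β / 2 * J p.1 p.2) (fun p => {p.1} ∆ {p.2}) τ := by
  rw [pairGibbsWeight, gksWeight, gksHamiltonian_pair]

/-- `⟨F⟩_{Λ,J,0,β} = ⟨F(·free)⟩_{Λ;K}` with `K_{(z,w)} = (β/2) J_{z,w}`. [folklore] -/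
theorem expectIn_eq_gksExpect (F : SpinConfig (Site d) → ℝ) :
    expectIn J Λ β 0 F =
      gksExpect (univ : Finset (↥Λ × ↥Λ)) (fun p => β / 2 * J p.1 p.2) (fun p => {p.1} ∆ {p.2})
        (fun τ => F (glue Λ τ .free)) := by
  rw [expectIn, gksExpect, gksSum, gksSum]
  simp_rw [pairGibbsWeight_eq_gksWeight, one_mul]

/-- `⟨σ_A⟩_{Λ,J,0,β} = ⟨σ_{A∩Λ}⟩_{Λ;K}`. [folklore] -/
theorem expectIn_spinProduct_eq_gksExpect (A : Finset (Site d)) :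
    expectIn J Λ β 0 (spinProduct A) =
      gksExpect (univ : Finset (↥Λ × ↥Λ)) (fun p => β / 2 * J p.1 p.2) (fun p => {p.1} ∆ {p.2})
        (spinProduct (inVol Λ A)) := by
  rw [expectIn_eq_gksExpect]
  simp_rw [spinProduct_glue_free]

/-- **Griffiths' first inequality for ferromagnetic pair interactions**: `⟨σ_A⟩_{Λ,J,0,β} ≥ 0` for
`β ≥ 0`, `J ≥ 0` (Griffiths 1967; Friedli–Velenik 2017, Thm. 3.49 (3.54)).
[cite: FriedliVelenik2017, Thm. 3.49, eq. (3.54), p. 141] -/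
theorem expectIn_spinProduct_nonneg (hβ : 0 ≤ β) (hJ : ∀ x y, 0 ≤ J x y) (A : Finset (Site d)) :
    0 ≤ expectIn J Λ β 0 (spinProduct A) := by
  rw [expectIn_spinProduct_eq_gksExpect]
  exact gksExpect_spinProduct_nonneg _ _ _ (fun p _ => mul_nonneg (by positivity) (hJ _ _)) _

end Bridge

/-! ### Monotonicity in the volume (Griffiths II) -/

section Volume

variable (J : Site d → Site d → ℝ) (β : ℝ)

/-- The free expectation in `Λ₁` is the expectation in `Λ₂ ⊇ Λ₁` of the system whose couplings
across and outside `Λ₁` are switched off (the spins of `Λ₂ ∖ Λ₁` are then independent fair coins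
and cancel in the ratio; Friedli–Velenik 2017, Exercise 3.12).
[cite: FriedliVelenik2017, Exercise 3.12, p. 112] -/
theorem expectIn_spinProduct_eq_gksExpect_decoupled {Λ₁ Λ₂ A : Finset (Site d)} (hA : A ⊆ Λ₁)
    (h12 : Λ₁ ⊆ Λ₂) :
    expectIn J Λ₁ β 0 (spinProduct A) =
      gksExpect (univ : Finset (↥Λ₂ × ↥Λ₂))
        (fun p => if (p.1 : Site d) ∈ Λ₁ ∧ (p.2 : Site d) ∈ Λ₁ then β / 2 * J p.1 p.2 else 0)
        (fun p => {p.1} ∆ {p.2}) (spinProduct (inVol Λ₂ A)) := by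
  obtain ⟨c, hc, hsum⟩ := exists_sum_comp_eq_smul ℤˣ (volIncl h12) (volIncl_injective h12)
  rw [expectIn_spinProduct_eq_gksExpect, gksExpect, gksExpect, gksSum, gksSum, gksSum, gksSum]
  have hw : ∀ τ : SpinConfig ↥Λ₂,
      gksWeight (univ : Finset (↥Λ₂ × ↥Λ₂))
        (fun p => if (p.1 : Site d) ∈ Λ₁ ∧ (p.2 : Site d) ∈ Λ₁ then β / 2 * J p.1 p.2 else 0)
        (fun p => {p.1} ∆ {p.2}) τ =
      gksWeight (univ : Finset (↥Λ₁ × ↥Λ₁)) (fun p => β / 2 * J p.1 p.2) (fun p => {p.1} ∆ {p.2})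
        (τ ∘ volIncl h12) := by
    intro τ
    rw [gksWeight, gksWeight, gksHamiltonian_pair_restrict J Λ₂ β h12, gksHamiltonian_pair,
      pairHamiltonian, zero_mul, sub_zero]
    have hs : ∑ x ∈ Λ₁, ∑ y ∈ Λ₁, J x y * (spinAt x (glue Λ₂ τ .free) * spinAt y (glue Λ₂ τ .free)) =
        ∑ x ∈ Λ₁, ∑ y ∈ Λ₁, J x y * spinAt x (glue Λ₁ (τ ∘ volIncl h12) .free) *
          spinAt y (glue Λ₁ (τ ∘ volIncl h12) .free) :=
      Finset.sum_congr rfl fun x hx => Finset.sum_congr rfl fun y hy => by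
        rw [spinAt_glue_comp_volIncl h12 τ .free .free hx, spinAt_glue_comp_volIncl h12 τ .free .free hy,
          mul_assoc]
    rw [hs]
    ring
  have hobs : ∀ τ : SpinConfig ↥Λ₂,
      spinProduct (inVol Λ₂ A) τ = spinProduct (inVol Λ₁ A) (τ ∘ volIncl h12) := by
    intro τ
    rw [← spinProduct_glue_free Λ₂ A τ, ← spinProduct_glue_free Λ₁ A (τ ∘ volIncl h12)]
    exact Finset.prod_congr rfl fun x hx => (spinAt_glue_comp_volIncl h12 τ .free .free (hA hx)).symm
  simp_rw [hw, hobs]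
  rw [hsum (fun a => spinProduct (inVol Λ₁ A) a *
      gksWeight (univ : Finset (↥Λ₁ × ↥Λ₁)) (fun p => β / 2 * J p.1 p.2) (fun p => {p.1} ∆ {p.2}) a),
    hsum (fun a => 1 *
      gksWeight (univ : Finset (↥Λ₁ × ↥Λ₁)) (fun p => β / 2 * J p.1 p.2) (fun p => {p.1} ∆ {p.2}) a),
    nsmul_eq_mul, nsmul_eq_mul, mul_div_mul_left _ _ (by positivity)]

/-- **Monotonicity of free pair-interaction correlations in the volume** (Griffiths 1967;
Friedli–Velenik 2017, Exercise 3.12: `⟨σ_A⟩^∅_{Λ₁} ≤ ⟨σ_A⟩^∅_{Λ₂}` for `A ⊂ Λ₁ ⊂ Λ₂`, `β ≥ 0`,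
ferromagnetic couplings), by Griffiths' comparison of couplings `gksExpect_mono_of_abs_le`.
[cite: FriedliVelenik2017, Exercise 3.12, p. 112] -/
theorem expectIn_spinProduct_mono_volume (hβ : 0 ≤ β) (hJ : ∀ x y, 0 ≤ J x y)
    {Λ₁ Λ₂ A : Finset (Site d)} (hA : A ⊆ Λ₁) (h12 : Λ₁ ⊆ Λ₂) :
    expectIn J Λ₁ β 0 (spinProduct A) ≤ expectIn J Λ₂ β 0 (spinProduct A) := by
  rw [expectIn_spinProduct_eq_gksExpect_decoupled J β hA h12, expectIn_spinProduct_eq_gksExpect]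
  refine gksExpect_mono_of_abs_le _ _ (fun p _ => ?_) _
  have h0 : 0 ≤ β / 2 * J p.1 p.2 := mul_nonneg (by positivity) (hJ _ _)
  split_ifs
  · rw [abs_of_nonneg h0]
  · rw [abs_zero]; exact h0

end Volume

/-! ### Covariance under lattice symmetries of the coupling -/

section Translation

variable (J : Site d → Site d → ℝ) (β h : ℝ)

/-- `σ_x(σ ∘ ψ) = σ_{ψ x}(σ)`. [folklore] -/
theorem spinAt_comp {V W : Type*} (ψ : V → W) (σ : SpinConfig W) (x : V) :
    spinAt x (σ ∘ ψ) = spinAt (ψ x) σ := rfl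

/-- `H_{ψ(Λ),J,h}(σ) = H_{Λ,J,h}(σ ∘ ψ)` for a bijection `ψ` of `ℤ^d` preserving `J`. [folklore] -/
theorem pairHamiltonian_map_equiv (ψ : Site d ≃ Site d) (hJ : ∀ x y, J (ψ x) (ψ y) = J x y)
    (Λ : Finset (Site d)) (σ : SpinConfig (Site d)) :
    pairHamiltonian J (Λ.map ψ.toEmbedding) h σ = pairHamiltonian J Λ h (σ ∘ ψ) := by
  simp only [pairHamiltonian, Finset.sum_map, Equiv.coe_toEmbedding, hJ, spinAt_comp]

/-- **Covariance of the finite-volume Gibbs expectation**: for a bijection `ψ` of `ℤ^d` with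
`J_{ψx,ψy} = J_{x,y}`, `⟨F(σ ∘ ψ)⟩_{ψ(Λ),J,h,β} = ⟨F⟩_{Λ,J,h,β}` (relabelling `τ ↦ τ ∘ ψ` of the
finite sums; Friedli–Velenik 2017, Exercise 3.14 in finite volume). [cite: FriedliVelenik2017, Exercise 3.14, p. 115] -/
theorem expectIn_map_equiv (ψ : Site d ≃ Site d) (hJ : ∀ x y, J (ψ x) (ψ y) = J x y)
    (Λ : Finset (Site d)) (F : SpinConfig (Site d) → ℝ) :
    expectIn J (Λ.map ψ.toEmbedding) β h (fun σ => F (σ ∘ ψ)) = expectIn J Λ β h F := by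
  set Λ' := Λ.map ψ.toEmbedding with hΛ'
  have hmem : ∀ x, x ∈ Λ ↔ ψ x ∈ Λ' := fun x => (Finset.mem_map' ψ.toEmbedding).symm
  set eΛ : ↥Λ ≃ ↥Λ' := ψ.subtypeEquiv hmem with heΛ
  set E : SpinConfig ↥Λ' ≃ SpinConfig ↥Λ := (Equiv.arrowCongr eΛ (Equiv.refl ℤˣ)).symm with hE
  have hE' : ∀ τ' : SpinConfig ↥Λ', E τ' = τ' ∘ eΛ := fun τ' => rfl
  have hglue : ∀ τ' : SpinConfig ↥Λ', glue Λ (τ' ∘ eΛ) .free = glue Λ' τ' .free ∘ ψ := by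
    intro τ'
    funext x
    simp only [Function.comp_apply]
    by_cases hx : x ∈ Λ
    · rw [glue_apply_of_mem _ _ _ hx, glue_apply_of_mem _ _ _ ((hmem x).1 hx)]
      rfl
    · rw [glue_apply_of_notMem _ _ _ hx, glue_apply_of_notMem _ _ _ (fun h' => hx ((hmem x).2 h'))]
      rfl
  have hw : ∀ τ' : SpinConfig ↥Λ', pairGibbsWeight J Λ β h (τ' ∘ eΛ) = pairGibbsWeight J Λ' β h τ' := by
    intro τ'
    rw [pairGibbsWeight, pairGibbsWeight, hglue, ← pairHamiltonian_map_equiv J h ψ hJ Λ]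
  rw [expectIn, expectIn]
  congr 1
  · rw [← Equiv.sum_comp E]
    refine Finset.sum_congr rfl fun τ' _ => ?_
    rw [hE', hw, hglue]
  · rw [← Equiv.sum_comp E]
    exact Finset.sum_congr rfl fun τ' _ => by rw [hE', hw]

/-- Translates of spin products: `⟨σ_{A+a}⟩_{Λ+a,J,h,β} = ⟨σ_A⟩_{Λ,J,h,β}` for translation-invariant
`J`. [cite: FriedliVelenik2017, Exercise 3.14, p. 115] -/
theorem expectIn_spinProduct_map_addRight (a : Site d) (hJ : ∀ x y, J (x + a) (y + a) = J x y)
    (Λ A : Finset (Site d)) :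
    expectIn J (Λ.map (Equiv.addRight a).toEmbedding) β h
        (spinProduct (A.map (Equiv.addRight a).toEmbedding)) =
      expectIn J Λ β h (spinProduct A) := by
  have h1 : spinProduct (A.map (Equiv.addRight a).toEmbedding) =
      fun σ : SpinConfig (Site d) => spinProduct A (σ ∘ Equiv.addRight a) := by
    funext σ
    rw [spinProduct, spinProduct, Finset.prod_map]
    rfl
  rw [h1]
  exact expectIn_map_equiv J β h (Equiv.addRight a) hJ Λ (spinProduct A)

end Translation

/-! ### The infinite-volume limit along boxes: existence (monotone convergence) and first properties -/

section BoxLimit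

variable (J : Site d → Site d → ℝ) (β : ℝ)

/-- Free pair-interaction correlations along the boxes containing `A` are nondecreasing
(`β ≥ 0`, `J ≥ 0`). [cite: FriedliVelenik2017, Exercise 3.12, p. 112] -/
theorem monotone_expectIn_box (hβ : 0 ≤ β) (hJ : ∀ x y, 0 ≤ J x y) {A : Finset (Site d)} {L₀ : ℕ}
    (hL₀ : ∀ L, L₀ ≤ L → A ⊆ box d L) :
    Monotone fun n : ℕ => expectIn J (box d (n + L₀)) β 0 (spinProduct A) := by
  refine monotone_nat_of_le_succ fun n => ?_
  exact expectIn_spinProduct_mono_volume J β hβ hJ (hL₀ _ (by omega)) (box_mono d (by omega))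

/-- **Existence of the infinite-volume two-point (and `n`-point) functions** ("Using Griffiths'
inequalities, one can obtain the associated infinite volume Gibbs measure by taking weak limits of
`⟨·⟩_{Λ,J,h,β}` as `Λ ↗ ℤ^d`", Panis 2023, §1.2.1): for `β ≥ 0`, `J ≥ 0`, `⟨σ_A⟩_{Λ_L,J,0,β}` is
eventually nondecreasing and bounded, hence converges to `state J β 0 σ_A`.
[cite: Panis2023Triviality, §1.2.1 (infinite volume Gibbs measure)] -/
theorem tendsto_expectIn_box (hβ : 0 ≤ β) (hJ : ∀ x y, 0 ≤ J x y) (A : Finset (Site d)) :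
    Tendsto (fun L : ℕ => expectIn J (box d L) β 0 (spinProduct A)) atTop
      (𝓝 (state J β 0 (spinProduct A))) := by
  obtain ⟨L₀, hL₀⟩ := exists_forall_subset_box d A
  set u : ℕ → ℝ := fun L => expectIn J (box d L) β 0 (spinProduct A) with hu
  have hmono : Monotone (fun n => u (n + L₀)) := monotone_expectIn_box J β hβ hJ hL₀
  have hbdd : BddAbove (Set.range fun n => u (n + L₀)) := by
    refine ⟨1, ?_⟩
    rintro _ ⟨n, rfl⟩
    exact (le_abs_self _).trans (abs_expectIn_le_one J _ β 0 fun σ => abs_spinProduct_le_one A σ)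
  have hconv : Tendsto u atTop (𝓝 (⨆ n, u (n + L₀))) :=
    (Filter.tendsto_add_atTop_iff_nat L₀).1 (tendsto_atTop_ciSup hmono hbdd)
  exact tendsto_nhds_limUnder ⟨_, hconv⟩

/-- `⟨σ_A⟩_{Λ,J,0,β} ≤ ⟨σ_A⟩_{J,0,β}` for every finite `Λ ⊇ A` (monotone limit).
[cite: FriedliVelenik2017, Exercise 3.12, p. 112] -/
theorem expectIn_le_state (hβ : 0 ≤ β) (hJ : ∀ x y, 0 ≤ J x y) {Λ A : Finset (Site d)} (hA : A ⊆ Λ) :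
    expectIn J Λ β 0 (spinProduct A) ≤ state J β 0 (spinProduct A) := by
  obtain ⟨L₁, hL₁⟩ := exists_forall_subset_box d Λ
  refine ge_of_tendsto (tendsto_expectIn_box J β hβ hJ A) ?_
  filter_upwards [eventually_ge_atTop L₁] with L hL
  exact expectIn_spinProduct_mono_volume J β hβ hJ hA (hL₁ L hL)

/-- GKS I in the limit: `0 ≤ ⟨σ_A⟩_{J,0,β}`. [cite: FriedliVelenik2017, Thm. 3.49, eq. (3.54), p. 141] -/
theorem state_spinProduct_nonneg (hβ : 0 ≤ β) (hJ : ∀ x y, 0 ≤ J x y) (A : Finset (Site d)) :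
    0 ≤ state J β 0 (spinProduct A) :=
  ge_of_tendsto' (tendsto_expectIn_box J β hβ hJ A) fun _ => expectIn_spinProduct_nonneg J _ β hβ hJ A

/-- `⟨c⟩_{J,h,β} = c`. [folklore] -/
theorem state_const (h c : ℝ) : state J β h (fun _ => c) = c := by
  rw [state]
  simp_rw [expectIn_const]
  exact tendsto_const_nhds.limUnder_eq

/-- **Translation invariance of the infinite-volume state on spin products**: for `β ≥ 0` and a
translation-invariant `J ≥ 0`, `⟨σ_{A+a}⟩_{J,0,β} = ⟨σ_A⟩_{J,0,β}` (covariance of the finite-volume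
expectations and monotonicity in the volume; Friedli–Velenik 2017, Exercise 3.14 / Thm. 3.17).
[cite: FriedliVelenik2017, Exercise 3.14, p. 115] -/
theorem state_spinProduct_map_addRight (hβ : 0 ≤ β) (hJ : ∀ x y, 0 ≤ J x y)
    (hJt : ∀ a x y, J (x + a) (y + a) = J x y) (a : Site d) (A : Finset (Site d)) :
    state J β 0 (spinProduct (A.map (Equiv.addRight a).toEmbedding)) = state J β 0 (spinProduct A) := by
  have key : ∀ (b : Site d) (B : Finset (Site d)),
      state J β 0 (spinProduct B) ≤ state J β 0 (spinProduct (B.map (Equiv.addRight b).toEmbedding)) := by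
    intro b B
    obtain ⟨L₀, hL₀⟩ := exists_forall_subset_box d B
    refine le_of_tendsto (tendsto_expectIn_box J β hβ hJ B) ?_
    filter_upwards [eventually_ge_atTop L₀] with L hL
    rw [← expectIn_spinProduct_map_addRight J β 0 b (hJt b) (box d L) B]
    exact expectIn_le_state J β hβ hJ (Finset.map_subset_map.2 (hL₀ L hL))
  refine le_antisymm ?_ (key a A)
  have h2 := key (-a) (A.map (Equiv.addRight a).toEmbedding)
  have hAA : (A.map (Equiv.addRight a).toEmbedding).map (Equiv.addRight (-a)).toEmbedding = A := by
    rw [Finset.map_map]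
    convert Finset.map_refl (s := A)
    ext x
    simp
  rwa [hAA] at h2

end BoxLimit

/-! ### The infinite-volume two-point function as a positive semi-definite kernel -/

section TwoPoint

variable (J : Site d → Site d → ℝ) (β : ℝ)

/-- Finite linear combinations of two-point functions pass to the limit:
`⟨∑ᵢⱼ aᵢⱼ σ_{pᵢ} σ_{qⱼ}⟩_{Λ_L} → ∑ᵢⱼ aᵢⱼ ⟨σ_{pᵢ} σ_{qⱼ}⟩` (`β ≥ 0`, `J ≥ 0`). [folklore] -/
theorem tendsto_expectIn_box_sum₂ (hβ : 0 ≤ β) (hJ : ∀ x y, 0 ≤ J x y) {ι κ : Type*} (s : Finset ι)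
    (t : Finset κ) (p : ι → Site d) (q : κ → Site d) (a : ι → κ → ℝ) :
    Tendsto (fun L : ℕ => expectIn J (box d L) β 0
        (fun σ => ∑ i ∈ s, ∑ j ∈ t, a i j * spinProduct ({p i} ∆ {q j}) σ)) atTop
      (𝓝 (∑ i ∈ s, ∑ j ∈ t, a i j * state J β 0 (spinProduct ({p i} ∆ {q j})))) := by
  have hlin : ∀ L : ℕ, expectIn J (box d L) β 0
      (fun σ => ∑ i ∈ s, ∑ j ∈ t, a i j * spinProduct ({p i} ∆ {q j}) σ) =
      ∑ i ∈ s, ∑ j ∈ t, a i j * expectIn J (box d L) β 0 (spinProduct ({p i} ∆ {q j})) := by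
    intro L
    rw [expectIn_finset_sum]
    refine Finset.sum_congr rfl fun i _ => ?_
    rw [expectIn_finset_sum]
    refine Finset.sum_congr rfl fun j _ => ?_
    rw [expectIn_const_mul]
  simp_rw [hlin]
  exact tendsto_finsetSum _ fun i _ => tendsto_finsetSum _ fun j _ =>
    (tendsto_expectIn_box J β hβ hJ _).const_mul _

/-- The infinite-volume expectation of a finite linear combination of pair products is the
corresponding combination of two-point functions. [folklore] -/
theorem state_sum₂ (hβ : 0 ≤ β) (hJ : ∀ x y, 0 ≤ J x y) {ι κ : Type*} (s : Finset ι)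
    (t : Finset κ) (p : ι → Site d) (q : κ → Site d) (a : ι → κ → ℝ) :
    state J β 0 (fun σ => ∑ i ∈ s, ∑ j ∈ t, a i j * spinProduct ({p i} ∆ {q j}) σ) =
      ∑ i ∈ s, ∑ j ∈ t, a i j * state J β 0 (spinProduct ({p i} ∆ {q j})) :=
  (tendsto_expectIn_box_sum₂ J β hβ hJ s t p q a).limUnder_eq

/-- **The two-point function is a positive semi-definite kernel**:
`∑ᵢⱼ cᵢ cⱼ ⟨σ_{pᵢ} σ_{pⱼ}⟩_{J,0,β} ≥ 0` (it is the limit of `⟨(∑ᵢ cᵢ σ_{pᵢ})²⟩_{Λ_L} ≥ 0`). [folklore] -/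
theorem sum_sum_mul_state_nonneg (hβ : 0 ≤ β) (hJ : ∀ x y, 0 ≤ J x y) {ι : Type*} (s : Finset ι)
    (p : ι → Site d) (c : ι → ℝ) :
    0 ≤ ∑ i ∈ s, ∑ j ∈ s, c i * c j * state J β 0 (spinProduct ({p i} ∆ {p j})) := by
  refine ge_of_tendsto' (tendsto_expectIn_box_sum₂ J β hβ hJ s s p p fun i j => c i * c j) fun L =>
    expectIn_nonneg J _ β 0 fun σ => ?_
  have hsq : ∑ i ∈ s, ∑ j ∈ s, c i * c j * spinProduct ({p i} ∆ {p j}) σ =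
      (∑ i ∈ s, c i * spinAt (p i) σ) ^ 2 := by
    rw [sq, Finset.sum_mul_sum]
    refine Finset.sum_congr rfl fun i _ => Finset.sum_congr rfl fun j _ => ?_
    rw [← spinAt_mul_spinAt_eq_spinProduct]
    ring
  rw [hsq]
  positivity

/-- Symmetry of the two-point function in its two sites. [folklore] -/
theorem state_pair_comm (x y : Site d) :
    state J β 0 (spinProduct ({y} ∆ {x})) = state J β 0 (spinProduct ({x} ∆ {y})) := by
  rw [symmDiff_comm]

/-- **Block inequality** (from positive semi-definiteness with `c = 1_{B₁} - 1_{B₂}`):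
`2 ∑_{x∈B₁,y∈B₂} ⟨σ_xσ_y⟩ ≤ ∑_{x,y∈B₁} ⟨σ_xσ_y⟩ + ∑_{x,y∈B₂} ⟨σ_xσ_y⟩`. [folklore] -/
theorem two_mul_sum_sum_state_le (hβ : 0 ≤ β) (hJ : ∀ x y, 0 ≤ J x y) (B₁ B₂ : Finset (Site d)) :
    2 * ∑ x ∈ B₁, ∑ y ∈ B₂, state J β 0 (spinProduct ({x} ∆ {y})) ≤
      ∑ x ∈ B₁, ∑ y ∈ B₁, state J β 0 (spinProduct ({x} ∆ {y})) +
        ∑ x ∈ B₂, ∑ y ∈ B₂, state J β 0 (spinProduct ({x} ∆ {y})) := by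
  set S : Site d → Site d → ℝ := fun x y => state J β 0 (spinProduct ({x} ∆ {y})) with hS
  have h := sum_sum_mul_state_nonneg J β hβ hJ (B₁.disjSum B₂) (Sum.elim id id)
    (Sum.elim (fun _ => (1 : ℝ)) (fun _ => -1))
  simp only [Finset.sum_disjSum, Sum.elim_inl, Sum.elim_inr, id, one_mul, mul_one, neg_mul,
    mul_neg, Finset.sum_neg_distrib, Finset.sum_add_distrib] at h
  have hsymm : ∑ x ∈ B₂, ∑ y ∈ B₁, S x y = ∑ x ∈ B₁, ∑ y ∈ B₂, S x y := by
    rw [Finset.sum_comm]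
    exact Finset.sum_congr rfl fun x _ => Finset.sum_congr rfl fun y _ => state_pair_comm J β x y
  simp only [hS] at hsymm
  linarith

/-- Translation invariance of the two-point function: `⟨σ_{x+a} σ_{y+a}⟩ = ⟨σ_x σ_y⟩`.
[cite: FriedliVelenik2017, Exercise 3.14, p. 115] -/
theorem state_pair_add (hβ : 0 ≤ β) (hJ : ∀ x y, 0 ≤ J x y) (hJt : ∀ a x y, J (x + a) (y + a) = J x y)
    (a x y : Site d) :
    state J β 0 (spinProduct ({x + a} ∆ {y + a})) = state J β 0 (spinProduct ({x} ∆ {y})) := by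
  rw [← state_spinProduct_map_addRight J β hβ hJ hJt a ({x} ∆ {y}), Finset.map_eq_image,
    Finset.image_symmDiff _ _ (Equiv.addRight a).toEmbedding.injective, Finset.image_singleton,
    Finset.image_singleton]
  rfl

/-- `⟨σ_x σ_x⟩ = 1`. [folklore] -/
theorem state_pair_self (x : Site d) : state J β 0 (spinProduct ({x} ∆ {x})) = 1 := by
  rw [symmDiff_self, Finset.bot_eq_empty]
  have h1 : (spinProduct (∅ : Finset (Site d)) : SpinConfig (Site d) → ℝ) = fun _ => 1 :=
    funext fun σ => spinProduct_empty σ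
  rw [h1, state_const]

/-- `Σ_L(β) = ∑_{x,y ∈ Λ_L} ⟨σ_x σ_y⟩_β` (Panis 2023, §1.2.1, display defining `Σ_L(β)`).
[cite: Panis2023Triviality, §1.2.1 (Σ_L(β))] -/
theorem blockVariance_eq_sum (hβ : 0 ≤ β) (hJ : ∀ x y, 0 ≤ J x y) (L : ℕ) :
    blockVariance J β L = ∑ x ∈ box d L, ∑ y ∈ box d L, state J β 0 (spinProduct ({x} ∆ {y})) := by
  have hobs : (fun σ : SpinConfig (Site d) => (∑ x ∈ box d L, spinAt x σ) ^ 2) =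
      fun σ => ∑ x ∈ box d L, ∑ y ∈ box d L, (1 : ℝ) * spinProduct ({x} ∆ {y}) σ := by
    funext σ
    rw [sq, Finset.sum_mul_sum]
    simp_rw [one_mul, spinAt_mul_spinAt_eq_spinProduct]
  rw [blockVariance, hobs, state_sum₂ J β hβ hJ (box d L) (box d L) (fun x => x) (fun y => y) fun _ _ => 1]
  simp_rw [one_mul]

/-- `Σ_L(β) ≥ 1` (`⟨σ_xσ_x⟩ = 1` and Griffiths I for the off-diagonal terms). [folklore] -/
theorem one_le_blockVariance (hβ : 0 ≤ β) (hJ : ∀ x y, 0 ≤ J x y) (L : ℕ) : 1 ≤ blockVariance J β L := by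
  rw [blockVariance_eq_sum J β hβ hJ L]
  calc (1 : ℝ) ≤ #(box d L) := by exact_mod_cast (box_nonempty d L).card_pos
    _ = ∑ x ∈ box d L, state J β 0 (spinProduct ({x} ∆ {x})) := by
        rw [Finset.sum_congr rfl fun x _ => state_pair_self J β x, Finset.sum_const, nsmul_eq_mul,
          mul_one]
    _ ≤ ∑ x ∈ box d L, ∑ y ∈ box d L, state J β 0 (spinProduct ({x} ∆ {y})) :=
        Finset.sum_le_sum fun x hx => Finset.single_le_sum
          (f := fun y => state J β 0 (spinProduct ({x} ∆ {y})))
          (fun y _ => state_spinProduct_nonneg J β hβ hJ _) hx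

end TwoPoint

/-! ### Covering `Λ_{NL}` by the translates `Λ_L + (2L+1)k`, `k ∈ Λ_N` -/

section Covering

/-- A nonnegative function summed over `Λ_{NL}` is at most its sum over the `(2N+1)^d` translates
`Λ_L + (2L+1)k`, `k ∈ Λ_N`, which cover `Λ_{NL}` (Euclidean division of each coordinate by `2L+1`).
[folklore] -/
theorem sum_box_mul_le_of_nonneg (N L : ℕ) (g : Site d → ℝ) (hg : ∀ x, 0 ≤ g x) :
    ∑ x ∈ box d (N * L), g x ≤
      ∑ k ∈ box d N, ∑ r ∈ box d L, g (r + (2 * (L : ℤ) + 1) • k) := by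
  set m : ℤ := 2 * (L : ℤ) + 1 with hm
  have hm0 : 0 < m := by omega
  set t : Site d → Site d := fun x i => (x i + L) / m with ht
  have hT1 : ∀ x : Site d, x - m • t x ∈ box d L := by
    intro x
    rw [mem_box]
    intro i
    have h1 := Int.mul_ediv_add_emod (x i + L) m
    have h2 := Int.emod_nonneg (x i + L) hm0.ne'
    have h3 := Int.emod_lt_of_pos (x i + L) hm0
    simp only [Pi.sub_apply, Pi.smul_apply, smul_eq_mul, ht]
    constructor <;> linarith
  have hT2 : ∀ x ∈ box d (N * L), t x ∈ box d N := by
    intro x hx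
    rw [mem_box] at hx ⊢
    intro i
    obtain ⟨hx1, hx2⟩ := hx i
    push_cast at hx1 hx2
    have hNL : (0 : ℤ) ≤ N * L := by positivity
    have hN : (0 : ℤ) ≤ N := by positivity
    have hL : (0 : ℤ) ≤ L := by positivity
    simp only [ht]
    constructor
    · rw [Int.le_ediv_iff_mul_le hm0]
      nlinarith
    · have h4 : (x i + ↑L) / m < N + 1 := by
        rw [Int.ediv_lt_iff_lt_mul hm0]
        nlinarith
      omega
  calc ∑ x ∈ box d (N * L), g x
      = ∑ k ∈ box d N, ∑ x ∈ (box d (N * L)).filter (fun x => t x = k), g x :=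
        (Finset.sum_fiberwise_of_maps_to hT2 g).symm
    _ ≤ ∑ k ∈ box d N, ∑ x ∈ (box d L).image (fun r => r + m • k), g x := by
        refine Finset.sum_le_sum fun k _ => Finset.sum_le_sum_of_subset_of_nonneg (fun x hx => ?_)
          (fun x _ _ => hg x)
        rw [Finset.mem_filter] at hx
        refine Finset.mem_image.2 ⟨x - m • k, ?_, sub_add_cancel x _⟩
        rw [← hx.2]
        exact hT1 x
    _ = ∑ k ∈ box d N, ∑ r ∈ box d L, g (r + m • k) := by
        refine Finset.sum_congr rfl fun k _ => ?_
        rw [Finset.sum_image fun r _ r' _ h => add_right_cancel h]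

/-- **Doubling-type bound for translation-invariant positive semi-definite nonnegative kernels**:
if `S ≥ 0`, `S(x+a,y+a) = S(x,y)` and `2S(B₁,B₂) ≤ S(B₁,B₁) + S(B₂,B₂)` for all finite blocks, then
`∑_{x,y ∈ Λ_{NL}} S(x,y) ≤ |Λ_N|² ∑_{x,y ∈ Λ_L} S(x,y)` (cover `Λ_{NL}` by the translates
`Λ_L + (2L+1)k`, `k ∈ Λ_N`, and bound each of the `|Λ_N|²` blocks by the diagonal one). [folklore] -/
theorem sum_sum_box_mul_le (S : Site d → Site d → ℝ) (hS0 : ∀ x y, 0 ≤ S x y)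
    (hSt : ∀ a x y, S (x + a) (y + a) = S x y)
    (hblock : ∀ B₁ B₂ : Finset (Site d), 2 * ∑ x ∈ B₁, ∑ y ∈ B₂, S x y ≤
      ∑ x ∈ B₁, ∑ y ∈ B₁, S x y + ∑ x ∈ B₂, ∑ y ∈ B₂, S x y) (N L : ℕ) :
    ∑ x ∈ box d (N * L), ∑ y ∈ box d (N * L), S x y ≤
      (#(box d N) : ℝ) ^ 2 * ∑ x ∈ box d L, ∑ y ∈ box d L, S x y := by
  set m : ℤ := 2 * (L : ℤ) + 1 with hm
  set V := ∑ x ∈ box d L, ∑ y ∈ box d L, S x y with hV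
  have h1 : ∑ x ∈ box d (N * L), ∑ y ∈ box d (N * L), S x y ≤
      ∑ k ∈ box d N, ∑ r ∈ box d L, ∑ k' ∈ box d N, ∑ r' ∈ box d L, S (r + m • k) (r' + m • k') := by
    calc ∑ x ∈ box d (N * L), ∑ y ∈ box d (N * L), S x y
        ≤ ∑ k ∈ box d N, ∑ r ∈ box d L, ∑ y ∈ box d (N * L), S (r + m • k) y :=
          sum_box_mul_le_of_nonneg N L (fun x => ∑ y ∈ box d (N * L), S x y) fun x =>
            Finset.sum_nonneg fun y _ => hS0 x y
      _ ≤ _ := Finset.sum_le_sum fun k _ => Finset.sum_le_sum fun r _ =>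
          sum_box_mul_le_of_nonneg N L (fun y => S (r + m • k) y) fun y => hS0 _ _
  have hdiag : ∀ k : Site d, ∑ r ∈ box d L, ∑ r' ∈ box d L, S (r + m • k) (r' + m • k) = V :=
    fun k => Finset.sum_congr rfl fun r _ => Finset.sum_congr rfl fun r' _ => hSt _ _ _
  have himg : ∀ c c' : Site d,
      ∑ x ∈ (box d L).image (· + c), ∑ y ∈ (box d L).image (· + c'), S x y =
        ∑ r ∈ box d L, ∑ r' ∈ box d L, S (r + c) (r' + c') := by
    intro c c'
    rw [Finset.sum_image fun r _ r' _ h => add_right_cancel h]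
    refine Finset.sum_congr rfl fun r _ => ?_
    rw [Finset.sum_image fun r _ r' _ h => add_right_cancel h]
  have hblk : ∀ k k' : Site d, ∑ r ∈ box d L, ∑ r' ∈ box d L, S (r + m • k) (r' + m • k') ≤ V := by
    intro k k'
    have hb := hblock ((box d L).image (· + m • k)) ((box d L).image (· + m • k'))
    rw [himg, himg, himg, hdiag, hdiag] at hb
    linarith
  calc ∑ x ∈ box d (N * L), ∑ y ∈ box d (N * L), S x y ≤ _ := h1
    _ = ∑ k ∈ box d N, ∑ k' ∈ box d N, ∑ r ∈ box d L, ∑ r' ∈ box d L, S (r + m • k) (r' + m • k') :=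
        Finset.sum_congr rfl fun k _ => Finset.sum_comm
    _ ≤ ∑ k ∈ box d N, ∑ k' ∈ box d N, V :=
        Finset.sum_le_sum fun k _ => Finset.sum_le_sum fun k' _ => hblk k k'
    _ = (#(box d N) : ℝ) ^ 2 * V := by
        rw [Finset.sum_const, Finset.sum_const, smul_smul, nsmul_eq_mul]
        push_cast
        ring

end Covering

/-! ### The smeared observable and the variance bound -/

section Variance

variable (J : Site d → Site d → ℝ) (β : ℝ)

/-- A compactly supported `f` on `ℝ^d` vanishes at `x/L` unless `x ∈ Λ_{NL}`, for some `N ≥ 1`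
depending only on `f` (the `r_f` of Panis 2023, Theorem 1.2, rounded up).
[cite: Panis2023Triviality, Theorem 1.2 (r_f)] -/
theorem exists_box_of_hasCompactSupport (f : EuclideanSpace ℝ (Fin d) → ℝ) (hfs : HasCompactSupport f) :
    ∃ N : ℕ, 1 ≤ N ∧ ∀ L : ℕ, 1 ≤ L → ∀ x : Site d,
      f ((L : ℝ)⁻¹ • siteVec x) ≠ 0 → x ∈ box d (N * L) := by
  obtain ⟨R, hR, hfR⟩ := hfs.exists_pos_le_norm
  refine ⟨max 1 ⌈R⌉₊, le_max_left _ _, fun L hL x hx => ?_⟩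
  set N : ℕ := max 1 ⌈R⌉₊ with hN
  have hlt : ‖(L : ℝ)⁻¹ • siteVec x‖ < R := lt_of_not_ge fun h' => hx (hfR _ h')
  have hLpos : (0 : ℝ) < L := by exact_mod_cast hL
  rw [mem_box]
  intro i
  have hi : ‖((L : ℝ)⁻¹ • siteVec x) i‖ ≤ ‖(L : ℝ)⁻¹ • siteVec x‖ := PiLp.norm_apply_le _ i
  rw [Real.norm_eq_abs, PiLp.smul_apply, siteVec_apply, smul_eq_mul, abs_mul,
    abs_of_pos (inv_pos.2 hLpos), inv_mul_le_iff₀ hLpos] at hi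
  have h2 : R ≤ (N : ℝ) := (Nat.le_ceil R).trans (by exact_mod_cast le_max_right 1 ⌈R⌉₊)
  have h3 : |(x i : ℝ)| ≤ ((N * L : ℕ) : ℝ) := by
    push_cast
    calc |(x i : ℝ)| ≤ (L : ℝ) * ‖(L : ℝ)⁻¹ • siteVec x‖ := hi
      _ ≤ (L : ℝ) * N := mul_le_mul_of_nonneg_left (hlt.le.trans h2) hLpos.le
      _ = (N : ℝ) * L := mul_comm _ _
  obtain ⟨h4, h5⟩ := abs_le.1 h3
  constructor
  · exact_mod_cast h4
  · exact_mod_cast h5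

/-- `T_{f,L,β}(σ)² = Σ_L(β)⁻¹ ∑_{x,y ∈ Λ_{NL}} f(x/L) f(y/L) σ_x σ_y` when `f(x/L) = 0` off `Λ_{NL}`.
[cite: Panis2023Triviality, §1.2.1 (T_{f,L,β})] -/
theorem smeared_sq_eq (f : EuclideanSpace ℝ (Fin d) → ℝ) {N L : ℕ}
    (hsupp : ∀ x : Site d, f ((L : ℝ)⁻¹ • siteVec x) ≠ 0 → x ∈ box d (N * L))
    (hV : 0 ≤ blockVariance J β L) (σ : SpinConfig (Site d)) :
    smeared J β L f σ ^ 2 = ∑ x ∈ box d (N * L), ∑ y ∈ box d (N * L),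
      (f ((L : ℝ)⁻¹ • siteVec x) * f ((L : ℝ)⁻¹ • siteVec y) / blockVariance J β L) *
        spinProduct ({x} ∆ {y}) σ := by
  rw [smeared, div_pow, Real.sq_sqrt hV]
  have hfin : ∑ᶠ x : Site d, f ((L : ℝ)⁻¹ • siteVec x) * spinAt x σ =
      ∑ x ∈ box d (N * L), f ((L : ℝ)⁻¹ • siteVec x) * spinAt x σ := by
    apply finsum_eq_sum_of_support_subset
    intro x hx
    rw [Function.mem_support] at hx
    exact Finset.mem_coe.2 (hsupp x fun h0 => hx (by rw [h0, zero_mul]))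
  rw [hfin, sq, Finset.sum_mul_sum, Finset.sum_div]
  refine Finset.sum_congr rfl fun x _ => ?_
  rw [Finset.sum_div]
  refine Finset.sum_congr rfl fun y _ => ?_
  rw [← spinAt_mul_spinAt_eq_spinProduct]
  ring

/-- **The smeared variances are bounded above, for every ferromagnetic translation-invariant pair
interaction and every `β ≥ 0`**: for `f ∈ C_c(ℝ^d)` there is `C_f` (here `‖f‖_∞² (2N_f+1)^{2d}`) with
`⟨T_{f,L,β}²⟩_{J,0,β} ≤ C_f` for all `L ≥ 1`. Proof: `⟨T²⟩ = Σ_L⁻¹ ∑ f f ⟨σ_xσ_y⟩ ≤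
‖f‖_∞² Σ_L⁻¹ ∑_{x,y∈Λ_{NL}} ⟨σ_xσ_y⟩` (Griffiths I) and `∑_{Λ_{NL}²} ⟨σ_xσ_y⟩ ≤ (2N+1)^{2d} Σ_L`
(covering by translates, positive semi-definiteness and translation invariance of the two-point
function). [cite: Panis2023Triviality, §1.2.1 (footnote on ⟨T_{f,L,β}²⟩)] -/
theorem state_smeared_sq_le (hβ : 0 ≤ β) (hJ : ∀ x y, 0 ≤ J x y)
    (hJt : ∀ a x y, J (x + a) (y + a) = J x y) (f : EuclideanSpace ℝ (Fin d) → ℝ)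
    (hf : Continuous f) (hfs : HasCompactSupport f) :
    ∃ Cf : ℝ, ∀ L : ℕ, 1 ≤ L → state J β 0 (fun σ => smeared J β L f σ ^ 2) ≤ Cf := by
  obtain ⟨N, hN, hsupp⟩ := exists_box_of_hasCompactSupport f hfs
  obtain ⟨M, hM⟩ := hf.bounded_above_of_compact_support hfs
  refine ⟨M ^ 2 * (#(box d N) : ℝ) ^ 2, fun L hL => ?_⟩
  set S : Site d → Site d → ℝ := fun x y => state J β 0 (spinProduct ({x} ∆ {y})) with hS
  set V := blockVariance J β L with hV
  have hV1 : 1 ≤ V := one_le_blockVariance J β hβ hJ L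
  have hV0 : 0 < V := by linarith
  have hS0 : ∀ x y, 0 ≤ S x y := fun x y => state_spinProduct_nonneg J β hβ hJ _
  -- `⟨T²⟩` as a finite combination of two-point functions
  have hT : state J β 0 (fun σ => smeared J β L f σ ^ 2) =
      ∑ x ∈ box d (N * L), ∑ y ∈ box d (N * L),
        (f ((L : ℝ)⁻¹ • siteVec x) * f ((L : ℝ)⁻¹ • siteVec y) / V) * S x y := by
    have hobs : (fun σ => smeared J β L f σ ^ 2) = fun σ => ∑ x ∈ box d (N * L), ∑ y ∈ box d (N * L),
        (f ((L : ℝ)⁻¹ • siteVec x) * f ((L : ℝ)⁻¹ • siteVec y) / V) * spinProduct ({x} ∆ {y}) σ :=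
      funext fun σ => smeared_sq_eq J β f (hsupp L hL) hV0.le σ
    rw [hobs]
    exact state_sum₂ J β hβ hJ (box d (N * L)) (box d (N * L)) (fun x => x) (fun y => y) _
  -- bound the coefficients by `M² / V`
  have hcoef : ∀ x y : Site d,
      f ((L : ℝ)⁻¹ • siteVec x) * f ((L : ℝ)⁻¹ • siteVec y) / V ≤ M ^ 2 / V := by
    intro x y
    refine div_le_div_of_nonneg_right ?_ hV0.le
    have h1 := hM ((L : ℝ)⁻¹ • siteVec x)
    have h2 := hM ((L : ℝ)⁻¹ • siteVec y)
    rw [Real.norm_eq_abs] at h1 h2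
    calc f ((L : ℝ)⁻¹ • siteVec x) * f ((L : ℝ)⁻¹ • siteVec y)
        ≤ |f ((L : ℝ)⁻¹ • siteVec x) * f ((L : ℝ)⁻¹ • siteVec y)| := le_abs_self _
      _ = |f ((L : ℝ)⁻¹ • siteVec x)| * |f ((L : ℝ)⁻¹ • siteVec y)| := abs_mul _ _
      _ ≤ M * M := mul_le_mul h1 h2 (abs_nonneg _) ((abs_nonneg _).trans h1)
      _ = M ^ 2 := (sq M).symm
  have hT2 : state J β 0 (fun σ => smeared J β L f σ ^ 2) ≤
      M ^ 2 / V * ∑ x ∈ box d (N * L), ∑ y ∈ box d (N * L), S x y := by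
    rw [hT, Finset.mul_sum]
    refine Finset.sum_le_sum fun x _ => ?_
    rw [Finset.mul_sum]
    exact Finset.sum_le_sum fun y _ => mul_le_mul_of_nonneg_right (hcoef x y) (hS0 x y)
  -- the covering bound
  have hcover : ∑ x ∈ box d (N * L), ∑ y ∈ box d (N * L), S x y ≤ (#(box d N) : ℝ) ^ 2 * V := by
    rw [hV, blockVariance_eq_sum J β hβ hJ L]
    exact sum_sum_box_mul_le S hS0 (state_pair_add J β hβ hJ hJt)
      (two_mul_sum_sum_state_le J β hβ hJ) N L
  calc state J β 0 (fun σ => smeared J β L f σ ^ 2)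
      ≤ M ^ 2 / V * ∑ x ∈ box d (N * L), ∑ y ∈ box d (N * L), S x y := hT2
    _ ≤ M ^ 2 / V * ((#(box d N) : ℝ) ^ 2 * V) :=
        mul_le_mul_of_nonneg_left hcover (by positivity)
    _ = M ^ 2 * (#(box d N) : ℝ) ^ 2 := by
        field_simp

end Variance

end LongRangeIsing

open LongRangeIsing

/-- The algebraically decaying couplings are nonnegative. [cite: Panis2023Triviality, §1.2.1 ((A1) ferromagnetic)] -/
theorem algebraicCoupling_nonneg {d : ℕ} {C₀ : ℝ} (hC₀ : 0 ≤ C₀) (α : ℝ) (x y : Site d) :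
    0 ≤ algebraicCoupling d C₀ α x y := by
  unfold algebraicCoupling
  split_ifs
  · exact le_rfl
  · exact mul_nonneg hC₀ (Real.rpow_nonneg (Nat.cast_nonneg _) _)

/-- The algebraically decaying couplings are translation invariant. [cite: Panis2023Triviality, §1.2.1 ((A3) translation invariant)] -/
theorem algebraicCoupling_add {d : ℕ} (C₀ α : ℝ) (a x y : Site d) :
    algebraicCoupling d C₀ α (x + a) (y + a) = algebraicCoupling d C₀ α x y := by
  unfold algebraicCoupling
  rw [add_sub_add_right_eq_sub]
  simp only [add_left_inj]

/-- `β_c ≥ 0` (an infimum of positive reals, or `sInf ∅ = 0`). [cite: Panis2023Triviality, §1.2.1 (β_c)] -/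
theorem criticalBeta_nonneg {d : ℕ} (J : Site d → Site d → ℝ) : 0 ≤ LongRangeIsing.criticalBeta J :=
  Real.sInf_nonneg fun _ hb => hb.1.le

/-- **Discharge of the named fact `panis_variance_bound`** (Panis 2023, §1.2.1, footnote to the
definition of `T_{f,L,β}`: "`⟨T_{f,L,β}(σ)²⟩_β ≤ C_f < ∞` … by constants that only depend on
`f`"), here at `β = β_c` for the models `J_{x,y} = C₀|x-y|₁^{-d-α}`: from
`LongRangeIsing.state_smeared_sq_le` (Griffiths' inequalities, translation invariance and positive
semi-definiteness of the two-point function; the constant is `‖f‖_∞² (2N_f+1)^{2d}`).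
[cite: Panis2023Triviality, §1.2.1 (footnote on ⟨T_{f,L,β}²⟩)] -/
theorem panis_variance_bound_holds : panis_variance_bound := by
  intro d _ C₀ α hC₀ _ f hf hfs
  exact state_smeared_sq_le (algebraicCoupling d C₀ α) (LongRangeIsing.criticalBeta (algebraicCoupling d C₀ α))
    (criticalBeta_nonneg _) (algebraicCoupling_nonneg hC₀.le α) (algebraicCoupling_add C₀ α) f hf hfs

end Literature.Barriers.CriticalPhenomena
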